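import Literature.MathematicalPhysics.QuantumFieldTheory.Balaban1983to89.T4PeierlsDomination

/-!
# T4HistoryPeeling — row T4-U5.E-a (third (a) of U5.E): the instantiation target of the U5c weight slot reduced to a
SINGLE-SLOT conditional ratio bound on a run's own term family, the kernel PEELING theorem that turns it into the
erasure / fibre domination of `T4PeierlsDomination.PeierlsDom`, and the two-rate SLOT BUDGET assembled from the typed
ingredients R1 / R2 / R4 (cell `pub-balaban`, T4-DAG v4 §5 row T4-U5.E-a, node U5c; estimate cell EST: typed located
hypothesis with constants + kernel bookkeeping; the estimate itself is NOT kernel-proved and NOT printed — see below)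

HONEST FRAMING (cell `pub-balaban`, T4-DAG PAGE 1).  The cell's T4 target is the existence AND uniqueness of the
continuum limit of Bałaban's unit-scale averaged loop expectations on a FIXED finite torus — strictly beyond ultraviolet
stability ([Balaban1989LargeFieldII] Thm 1 p. 355); it is NOT the Yang–Mills mass gap and NOT the Clay problem.  This
module serves ONE row of the cell's own uniqueness spine (node U5c, persistent-activity weight bound NE7b).  Nothing of
Bałaban's is asserted: every «…» below was READ BY THIS SEAT ON THE RENDERED JOURNAL PAGE (PNG ×2) and is quoted for
CONTEXT, SHAPE AND LOCATION ONLY; the one new hypothesis shape (`SlotDom`, §3) is consumed only as `(h : SlotDom …)` and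
is flagged NOT PRINTED.  Value = typed located hypothesis + kernel bookkeeping, NOT an estimate of Bałaban's expansion,
NOT summit progress.

CITATION HEADER.
* [Balaban1989LargeFieldII] = T. Bałaban, *Large field renormalization. II. Localization, exponentiation, and bounds for
  the ℝ operation*, Commun. Math. Phys. **122** (1989) 355–392 (cell paper B16; PDF page = journal page − 354; renders
  `b2b-balaban-ref1/pages/1989-cmp122-large-field-II/1989-cmp122-large-field-II-pNNN-x2.png`, NNN = PDF page).
  p. 383 [p029], after the estimates of the preparatory integrals: «The integrals with respect to the fields A_j in
  (2.21) [III], or (1.25) [IV], are estimated using the positivity properties of the quadratic forms, and we get the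
  factors exp O(1)|Z_j ∩ Ω_j|, where the volume is for the corresponding scale. Finally, the summations over the
  admissible sequences can be replaced by the factors exp O(1)(MR_j)^{−d}|Z_j|.» (the printed COUNTING of large-field
  data per unit of large-field volume — the model of ingredient R4 below), then (1.79): «T′_k(X)1 ≤ sup exp{Σ_{j=1}^{k}
  O(1)M^dR_j^{d+1}d′_j(Z_j)} · ∏_{j=1}^{k} ∏_i exp(−½γ₀A₁²p₀²(g_j)(d′_j(Z_j^{(i)}) + 1) − 2p₀(g_j)) ∏′ exp(−p₀(g_j)),
  (1.79) where the last product is over components of Z_j satisfying the conditions (i), (ii), for which some large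
  fields are created during the preparatory steps.» and, before it, «This is the largest factor among all the small
  factors we have obtained from the large field characteristic functions in the preparatory steps. We assume that
  2p₁ − (d + 5)r₀ > p₀, and we estimate the factors by exp(−p₀(g_j)).» (ONE small factor `exp(−p₀(g_j))` PER LARGE-FIELD
  REGION PER CREATION — the model of ingredient R1).  p. 384 [p030] (1.80) and p. 386–387 [p032–p033] (the renewal
  window `K`, its reset «K = R_{j+1}» for a renewed component and «K ≤ K₂ + n₁ + R_{j+1}» after a merger, and the merger
  surplus «2p₀(g_{j(X)}) + 2p₀(g_{j(Y)}) − 2p₀(g_{j(Z)}) ≥ 2(1 + β₀)^{−1}p₀(g_{j+1})» discarded in (1.88)) are quoted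
  verbatim in the header of `T4WeightBudget` (v1.1) — the model of ingredient R2 (a structure still pending after its
  window underwent an EVENT: renewal or merger); p. 387 [p033] (1.89): «T′_k(X)1 ≤ exp(−2(1 + β₀)^{−1}p₀(g_k)). (1.89)».
  p. 390 [p036], WHAT IS EXPONENTIATED: «The estimate (1.97) is sufficient for convergence of the exponentiated cluster
  expansion, and we have {⋯} = exp R′^{(k)} = exp ΣR′^{(k)}(X). (1.98)» … «The exponentiation (1.98) completes the
  R-operation. Now we divide the terms R′^{(k)}(X) into two groups. To the first group we assign all the terms with the
  localization domains X intersecting the large field region Z_k^~ ∪ ⋃_{i=1}^{m} Y_i^~, to the second group the terms with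
  the domains disjoint with this region. The terms of the first group are new boundary terms, and they are denoted by
  B′^{(k)}(X).» and the new action «A_k(1/(g_k(·))², U_k) = A′_k(1/(g_k(·))², U_k) + Σ_X R′^{(k)}(X, U_k) +
  Σ_X B′^{(k)}(X, U_k). (1.101)»; p. 391 [p037]: «the induction hypothesis described in Sect. 2 [III]. This completes the
  proof of Theorem 1 and Corollary 3.» and the alternative representation (1.104); p. 392 [p038]: «For this
  representation the domains Y_i are still large field domains, but there are no integral operations connected with
  them, there are only the characteristic functions, the δ-functions and the functions T′_k(Y_i)1 multiplying the action
  density, hence T_k(Y_i) is the multiplication operation.» … «The contributions from the previous large field regions is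
  isolated in these boundary terms, and in the functions T′_k(Y_i)1.»
  WHAT THESE PAGES DO NOT PRINT (and this module does NOT assert): a representation of the final density of ONE run at
  cutoff `K` as a finite sum over large-field HISTORIES with a switch-off structure (§1), the single-slot conditional
  ratio bound (§3 `SlotDom`, uniform in the frozen context through all later steps), the identification of node U5b's
  bad class with "an old structure still pending at step K", and any RELATIVE weight bound.  These are the cell's NE7b;
  this module only fixes their TYPE and proves the bookkeeping around them.
* [King1986] = C. King, Commun. Math. Phys. **102** (1986) 649–677, (3.10)–(3.11) p. 656 — the printed MODEL of
  "matched part + large-field complement bounded by weight" (quoted in `T4WeightBudget`); CONTEXT ONLY.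

THE POINT.  After rows T4-U5c.E (`T4WeightBudget.RelWeightBound`), T4-U5c.E-KP/KP2 (`T4WeightBudgetKP.PolymerDom`) and
T4-U5.E-a-PF (`T4PeierlsDomination.PeierlsDom`: erasure + charge + FIBRE DOMINATION ⇒ `RelWeightBound`, gas-free and
KP-free), the estimate seat of row T4-U5.E-a owes, per run and per `(K, t)`, the fibre domination
`Σ_{τ bad : erase τ = τ′, charge τ = Q} A τ ≤ A τ′ · ∏_{σ ∈ Q} x σ` and the slot budget `Σ x ≤ S K`, `Σ_K S K < ∞`.
This module reduces the first to its PRIMITIVE, LOCAL form and assembles the second from typed counting ingredients: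
§1 SWITCH-OFF CALCULUS on a run's own finite term family `T` (no product structure of the weights is assumed): slots
   `Fin n`; for each slot a pending-flag `pend i : ι → Bool` and a switch-off map `off i : ι → ι` with the four axioms of
   `SwitchOff` (off lands in `T`, clears its own flag, leaves the other flags alone, and fixes terms whose flag is
   already clear); derived: `charge`, `bad`, the ordered total erasure `erase = off (n−1) ∘ ⋯ ∘ off 0` (`eraseUpTo`), and
   `erase τ ∈ T ∖ bad`.
§2 THE PEELING THEOREM `SwitchOff.fibre_dom`: the SINGLE-SLOT CONDITIONAL RATIO BOUND
   `∀ i, ∀ τ″ ∈ T with pend i τ″ = false:  Σ_{τ ∈ T : pend i τ ∧ off i τ = τ″} A τ ≤ x i · A τ″`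
   (switching slot `i` ON in a frozen context costs at most `x i`, UNIFORMLY in the context — in particular in contexts
   where other slots are on) implies, for non-negative weights and activities, the full fibre domination of
   `PeierlsDom` with `erase` / `charge` of §1 (induction over the slots in increasing order, `SwitchOff.peel_aux`; kernel:
   `Finset.sum_fiberwise_of_maps_to`, `Finset.prod_erase_mul`).
§3 THE U5 SHAPE `SlotDom l₀ T A Bad S` (per `(K, t)`: a switch-off structure on `T K` whose bad class is `Bad K t`,
   activities `x ≥ 0` of total `≤ S K`, and the single-slot bound) with `SlotDom.toPeierlsDom`,
   `relWeightBound_of_slotDom`, `cauchySum_of_crossover_slotDom` (binder-for-binder `cauchySum_of_crossover_peierlsDom`).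
§4 THE SLOT BUDGET from the typed ingredients: `recordSum_le` (R1 cost `≤ ρ^{#events}` per record, record entropy
   `≤ Γ^{#events}`, R2 `#events ≥ m₀` ⇒ slot activity `≤ (Γρ)^{m₀}/(1 − Γρ)`), `pow_eventCount_le_twoRate` (the window
   count `a ≤ N·(m₀ + 1)` of `T4WeightBudget.card_Icc_le_of_windows` converts `q^{m₀}` into the per-step rate
   `q⁻¹ · (q^{1/N})^{a}`), `slotBudget_le` (R4 count `#{slots born at scale j} ≤ V·Λ^{K−j}` and cost `x ≤ C·σ^{K−j}` ⇒
   `Σ x ≤ C·V·(Λσ)^{K−j⋆+1}/(1 − Λσ)`, = `T4WeightBudget.twoRate_majorant_le`), `summable_twoRateBudget` (⇒ `Σ_K S K < ∞`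
   when `c·K ≤ K − j⋆(K)`, = `T4WeightBudget.summable_weightMajorant`) and `twoRateBudget_nonneg`.
§5 SANITY: the INDEPENDENT-STRUCTURE MODEL `productSwitchOff` (terms `Fin n → Bool`, weight `a₀ · ∏_{i on} u i`): the
   single-slot bound holds with `x = u` and EQUALITY in each fibre (`productSwitchOff_single_slot`), so `SlotDom` is
   inhabited non-trivially (`slotDom_product`) — and the located hypothesis is literally "the softly coupled structures of
   the expansion cost, conditionally, no more than independent ones would".

THE TWO RECORDED FAILURE MODES OF ROW U5.E-a (addressed, not dissolved).  (F1) "domination must survive the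
ℝ-exponentiation between scales": by p. 390 the exponentiation (1.98) acts on the cluster terms R′^{(k)}(X) only and
lands in the ACTION (1.101); the large-field operations `T_k(Y)` of a PENDING structure are never exponentiated — they are
the history (representation (1.104), p. 392: multiplication by characteristic functions, δ-functions and `T′_k(Y_i)1`);
so in the dictionary of §3 the banked factors (1.79)/(1.89) of a pending structure are explicit factors of the history
weight and the switch-off acts on the history, not inside an exponent.  What (F1) really asks is then visible as the
CONTEXT-UNIFORMITY of the single-slot bound: switching a structure off changes the later small-field actions, boundary
terms B′^{(k)} and ℝ-operations near it — NOT PRINTED, located in `SlotDom.dom`'s last clause.  (F2) "signed activities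
at real t": the history weights of (1.104) at REAL `t` are products of non-negative multiplication operations applied to
`exp` of a REAL action, hence `≥ 0` (cell reading; the signed Mayer activities live inside the exponent only); the
peeling theorem needs exactly `A ≥ 0` on `T` and `x ≥ 0`, no Kotecký–Preiss condition and no polymer gas — the signed
route (`Literature.Probability.LatticeModels.PolymerLogZLipschitz`, row U5.L-S) is the alternative currency if the last
exponent is expanded instead, and is not used here.

Sources.  [Balaban1989LargeFieldII] pp. 383–392 — CONTEXT / LOCATION ONLY as above; [King1986] (3.10) — CONTEXT ONLY.
Everything proved below is elementary finite combinatorics and real analysis. [folklore]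
Unit `b2b-balaban-pv14` gen 5 (journal CLAIM T4-U5.E-a 2026-08-18T23:05:49Z); imports `T4PeierlsDomination` (row
T4-U5.E-a-PF, unit pv10 gen 5) and through it `T4WeightBudgetKP` / `T4WeightBudget` (this lineage).
-/

open Finset _root_.Filter _root_.Topology

namespace Literature.MathematicalPhysics.QuantumFieldTheory.Balaban1983to89.T4HistoryPeeling

open T4HybridMatching T4CauchySum T4Crossover T4WeightBudget T4WeightBudgetKP T4PeierlsDomination

/-! ## §1 The switch-off calculus on a finite term family -/

/-- **SWITCH-OFF STRUCTURE** on a finite term family `T` with `n` slots (DATA + four axioms; the cell's carrier for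
"large-field histories of one run at one cutoff", NOT a printed object).  `pend i τ` = "term `τ` carries a structure at
slot `i` which is still pending"; `off i τ` = "the same term with that structure switched off".  Axioms: `off i` maps `T`
into `T`, clears flag `i`, leaves every other flag unchanged, and fixes the terms whose flag `i` is already clear.  No
product structure of `T` or of the weights is assumed.  (Outside `T` one may always take `pend i := false`,
`off i := id`.)  The axioms are a MODELLING CONSTRAINT on the choice of flags (cell reading, NOT PRINTED): with slot
`i` = (birth scale, anchor cell), flag `i` := "a component still pending at the cutoff has its FIRST large-field region
([Balaban1989LargeFieldII] p. 384 «j(Z) is the index of a first large field region contained in Z») anchored at slot `i`"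
and `off i` := delete that WHOLE component (small-field branches on all its cubes at all scales), distinct components are
combinatorially independent, so the other flags are untouched (`pend_off_ne`); a flag defined by the pending status of a
single region would not satisfy it (mergers). [folklore] -/
structure SwitchOff {ι : Type*} (T : Finset ι) (n : ℕ) where
  /-- the pending flag of slot `i` on term `τ` -/
  pend : Fin n → ι → Bool
  /-- the switch-off map of slot `i` -/
  off : Fin n → ι → ι
  /-- switching off stays in the family -/
  off_mem : ∀ i τ, τ ∈ T → off i τ ∈ T
  /-- switching off slot `i` clears flag `i` -/
  pend_off_self : ∀ i τ, pend i (off i τ) = false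
  /-- … and leaves the other flags unchanged -/
  pend_off_ne : ∀ i i' τ, i' ≠ i → pend i' (off i τ) = pend i' τ
  /-- a term whose flag `i` is clear is fixed by `off i` -/
  off_of_pend : ∀ i τ, pend i τ = false → off i τ = τ

namespace SwitchOff

variable {ι : Type*} {T : Finset ι} {n : ℕ} (Φ : SwitchOff T n)

/-- The CHARGE of a term: the set of its pending slots. [folklore] -/
def charge (τ : ι) : Finset (Fin n) := univ.filter fun i => Φ.pend i τ = true

/-- The pending slots of index `< m` (the induction parameter of the peeling). [folklore] -/
def chargeLT (m : ℕ) (τ : ι) : Finset (Fin n) := univ.filter fun i => (i : ℕ) < m ∧ Φ.pend i τ = true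

/-- The BAD class: terms of `T` with at least one pending slot. [folklore] -/
def bad : Finset ι := T.filter fun τ => (Φ.charge τ).Nonempty

/-- Switch off the slots of index `< m`, in increasing order. [folklore] -/
def eraseUpTo : ℕ → ι → ι
  | 0, τ => τ
  | m + 1, τ => if h : m < n then Φ.off ⟨m, h⟩ (eraseUpTo m τ) else eraseUpTo m τ

/-- The total ERASURE: all slots switched off. [folklore] -/
def erase (τ : ι) : ι := Φ.eraseUpTo n τ

/-- Membership in the charge. [folklore] -/
@[simp] theorem mem_charge {i : Fin n} {τ : ι} : i ∈ Φ.charge τ ↔ Φ.pend i τ = true := by simp [charge]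

/-- Membership in the truncated charge. [folklore] -/
@[simp] theorem mem_chargeLT {m : ℕ} {i : Fin n} {τ : ι} :
    i ∈ Φ.chargeLT m τ ↔ (i : ℕ) < m ∧ Φ.pend i τ = true := by simp [chargeLT]

/-- Membership in the bad class. [folklore] -/
theorem mem_bad {τ : ι} : τ ∈ Φ.bad ↔ τ ∈ T ∧ (Φ.charge τ).Nonempty := by simp [bad]

/-- The bad class consists of terms. [folklore] -/
theorem bad_subset : Φ.bad ⊆ T := Finset.filter_subset _ _

/-- No slot has index `< 0`. [folklore] -/
theorem chargeLT_zero (τ : ι) : Φ.chargeLT 0 τ = ∅ := by ext i; simp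

/-- Past the last slot the truncated charge is the charge. [folklore] -/
theorem chargeLT_of_le {m : ℕ} (h : n ≤ m) (τ : ι) : Φ.chargeLT m τ = Φ.charge τ := by
  ext i
  simp only [mem_chargeLT, mem_charge, and_iff_right_iff_imp]
  intro _
  exact lt_of_lt_of_le i.isLt h

/-- The truncated charge at level `n` is the charge. [folklore] -/
theorem chargeLT_n (τ : ι) : Φ.chargeLT n τ = Φ.charge τ := Φ.chargeLT_of_le le_rfl τ

/-- Nothing is switched off at level `0`. [folklore] -/
@[simp] theorem eraseUpTo_zero (τ : ι) : Φ.eraseUpTo 0 τ = τ := rfl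

/-- The recursion step of `eraseUpTo` below the number of slots. [folklore] -/
theorem eraseUpTo_succ_of_lt {m : ℕ} (h : m < n) (τ : ι) :
    Φ.eraseUpTo (m + 1) τ = Φ.off ⟨m, h⟩ (Φ.eraseUpTo m τ) := by
  simp [eraseUpTo, h]

/-- The recursion step of `eraseUpTo` past the number of slots is trivial. [folklore] -/
theorem eraseUpTo_succ_of_le {m : ℕ} (h : n ≤ m) (τ : ι) : Φ.eraseUpTo (m + 1) τ = Φ.eraseUpTo m τ := by
  simp [eraseUpTo, not_lt.2 h]

/-- Switching off stays in the family (iterated). [folklore] -/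
theorem eraseUpTo_mem {τ : ι} (hτ : τ ∈ T) : ∀ m, Φ.eraseUpTo m τ ∈ T
  | 0 => by simpa using hτ
  | m + 1 => by
    by_cases h : m < n
    · rw [Φ.eraseUpTo_succ_of_lt h]; exact Φ.off_mem _ _ (eraseUpTo_mem hτ m)
    · rw [Φ.eraseUpTo_succ_of_le (not_lt.1 h)]; exact eraseUpTo_mem hτ m

/-- The erasure of a term of `T` is a term of `T`. [folklore] -/
theorem erase_mem {τ : ι} (hτ : τ ∈ T) : Φ.erase τ ∈ T := Φ.eraseUpTo_mem hτ n

/-- Switching off the slots `< m` leaves the flags of the slots `≥ m` unchanged. [folklore] -/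
theorem pend_eraseUpTo_of_le (τ : ι) : ∀ m, ∀ i : Fin n, m ≤ (i : ℕ) → Φ.pend i (Φ.eraseUpTo m τ) = Φ.pend i τ
  | 0, i, _ => by simp
  | m + 1, i, hi => by
    by_cases h : m < n
    · rw [Φ.eraseUpTo_succ_of_lt h, Φ.pend_off_ne]
      · exact pend_eraseUpTo_of_le τ m i (by omega)
      · intro heq; rw [heq] at hi; simp at hi
    · rw [Φ.eraseUpTo_succ_of_le (not_lt.1 h)]; exact pend_eraseUpTo_of_le τ m i (by omega)

/-- … and clears the flags of the slots `< m`. [folklore] -/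
theorem pend_eraseUpTo_of_lt (τ : ι) : ∀ m, ∀ i : Fin n, (i : ℕ) < m → Φ.pend i (Φ.eraseUpTo m τ) = false
  | 0, i, hi => by simp at hi
  | m + 1, i, hi => by
    by_cases h : m < n
    · rw [Φ.eraseUpTo_succ_of_lt h]
      by_cases him : (i : ℕ) = m
      · have : i = ⟨m, h⟩ := Fin.ext him
        subst this
        exact Φ.pend_off_self _ _
      · rw [Φ.pend_off_ne]
        · exact pend_eraseUpTo_of_lt τ m i (by omega)
        · intro heq; apply him; rw [heq]
    · rw [Φ.eraseUpTo_succ_of_le (not_lt.1 h)]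
      exact pend_eraseUpTo_of_lt τ m i (by have := i.isLt; omega)

/-- A term with no pending slot `< m` is fixed by `eraseUpTo m`. [folklore] -/
theorem eraseUpTo_eq_self (τ : ι) :
    ∀ m, (∀ i : Fin n, (i : ℕ) < m → Φ.pend i τ = false) → Φ.eraseUpTo m τ = τ
  | 0, _ => by simp
  | m + 1, h => by
    have ih : Φ.eraseUpTo m τ = τ := eraseUpTo_eq_self τ m fun i hi => h i (by omega)
    by_cases hm : m < n
    · rw [Φ.eraseUpTo_succ_of_lt hm, ih]
      exact Φ.off_of_pend _ _ (h ⟨m, hm⟩ (by simp))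
    · rw [Φ.eraseUpTo_succ_of_le (not_lt.1 hm), ih]

/-- All flags of the total erasure are clear. [folklore] -/
theorem pend_erase (τ : ι) (i : Fin n) : Φ.pend i (Φ.erase τ) = false :=
  Φ.pend_eraseUpTo_of_lt τ n i i.isLt

/-- The erasure has empty charge. [folklore] -/
theorem charge_erase (τ : ι) : Φ.charge (Φ.erase τ) = ∅ := by
  ext i; simp [Φ.pend_erase]

/-- **The erasure lands in the GOOD class** `T ∖ bad`. [folklore] -/
theorem erase_mem_sdiff [DecidableEq ι] {τ : ι} (hτ : τ ∈ T) : Φ.erase τ ∈ T \ Φ.bad := by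
  rw [Finset.mem_sdiff, mem_bad, Φ.charge_erase]
  exact ⟨Φ.erase_mem hτ, fun h => Finset.not_nonempty_empty h.2⟩

/-- A good term is its own erasure. [folklore] -/
theorem erase_eq_self_of_mem_sdiff [DecidableEq ι] {τ : ι} (hτ : τ ∈ T \ Φ.bad) : Φ.erase τ = τ := by
  refine Φ.eraseUpTo_eq_self τ n fun i _ => ?_
  rw [Finset.mem_sdiff, mem_bad] at hτ
  by_contra h
  exact hτ.2 ⟨hτ.1, ⟨i, by simpa using h⟩⟩

/-- Bad terms have nonempty charge. [folklore] -/
theorem charge_nonempty_of_mem_bad {τ : ι} (hτ : τ ∈ Φ.bad) : (Φ.charge τ).Nonempty := (Φ.mem_bad.1 hτ).2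

/-- A term of `T` with nonempty charge is bad. [folklore] -/
theorem mem_bad_of_charge_nonempty {τ : ι} (hτ : τ ∈ T) (h : (Φ.charge τ).Nonempty) : τ ∈ Φ.bad :=
  Φ.mem_bad.2 ⟨hτ, h⟩

/-! ## §2 The peeling theorem: single-slot conditional ratio bound ⇒ fibre domination -/

section Peeling

variable [DecidableEq ι] {A : ι → ℝ} {x : Fin n → ℝ}

/-- **PEELING, the induction over slots.**  Under the single-slot conditional ratio bound (switching slot `i` on in ANY
frozen context `τ″ ∈ T` with `pend i τ″ = false` costs at most the factor `x i`), non-negative weights on `T` and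
non-negative activities: for every `m`, every `τ′ ∈ T` with no pending slot `< m` and every `Q ⊆ {i : i < m}`, the terms
`τ ∈ T` with `eraseUpTo m τ = τ′` whose pending slots below `m` are exactly `Q` have total weight `≤ A τ′ · ∏_{i ∈ Q} x i`.
(Step `m → m + 1`: if slot `m ∉ Q` the fibre is the `m`-fibre; if `m ∈ Q`, regroup the fibre along `eraseUpTo m`
into contexts `τ″` with slot `m` on and `off m τ″ = τ′`, apply the induction hypothesis in each context and the
single-slot bound at slot `m`.) [folklore] -/
theorem peel_aux (hA : ∀ τ ∈ T, 0 ≤ A τ) (hx : ∀ i, 0 ≤ x i)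
    (h1 : ∀ i : Fin n, ∀ τ'' ∈ T, Φ.pend i τ'' = false →
      ∑ τ ∈ T with (Φ.pend i τ = true ∧ Φ.off i τ = τ''), A τ ≤ x i * A τ'') :
    ∀ m : ℕ, ∀ τ' ∈ T, (∀ i : Fin n, (i : ℕ) < m → Φ.pend i τ' = false) →
      ∀ Q : Finset (Fin n), (∀ i ∈ Q, (i : ℕ) < m) →
        ∑ τ ∈ T with (Φ.eraseUpTo m τ = τ' ∧ Φ.chargeLT m τ = Q), A τ ≤ A τ' * ∏ i ∈ Q, x i := by
  intro m
  induction m with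
  | zero =>
    intro τ' hτ' _ Q hQ
    have hQ0 : Q = ∅ := Finset.eq_empty_of_forall_notMem fun i hi => by have := hQ i hi; omega
    subst hQ0
    have hset : (T.filter fun τ => Φ.eraseUpTo 0 τ = τ' ∧ Φ.chargeLT 0 τ = ∅) = {τ'} := by
      ext τ
      simp only [Finset.mem_filter, eraseUpTo_zero, chargeLT_zero, and_true, Finset.mem_singleton]
      constructor
      · rintro ⟨_, rfl⟩; rfl
      · rintro rfl; exact ⟨hτ', rfl⟩
    rw [hset, Finset.sum_singleton, Finset.prod_empty, mul_one]
  | succ m ih =>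
    intro τ' hτ' hpτ' Q hQ
    by_cases hmn : m < n
    · set i₀ : Fin n := ⟨m, hmn⟩ with hi₀
      have hpτ'i₀ : Φ.pend i₀ τ' = false := hpτ' i₀ (by simp [hi₀])
      by_cases hQi : i₀ ∈ Q
      · -- slot `m` is charged: regroup along `eraseUpTo m`
        set Q₀ : Finset (Fin n) := Q.erase i₀ with hQ₀
        have hQ₀lt : ∀ i ∈ Q₀, (i : ℕ) < m := by
          intro i hi
          rw [hQ₀, Finset.mem_erase] at hi
          have h1' := hQ i hi.2
          have h2' : (i : ℕ) ≠ m := fun h => hi.1 (Fin.ext (by rw [h]))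
          omega
        set F : Finset ι := T.filter fun τ => Φ.eraseUpTo (m + 1) τ = τ' ∧ Φ.chargeLT (m + 1) τ = Q with hF
        set S'' : Finset ι := T.filter fun τ'' => Φ.pend i₀ τ'' = true ∧ Φ.off i₀ τ'' = τ' ∧
          ∀ j : Fin n, (j : ℕ) < m → Φ.pend j τ'' = false with hS''
        have hmaps : ∀ τ ∈ F, Φ.eraseUpTo m τ ∈ S'' := by
          intro τ hτ
          rw [hF, Finset.mem_filter] at hτ
          obtain ⟨hτT, hE, hC⟩ := hτ
          rw [hS'', Finset.mem_filter]
          refine ⟨Φ.eraseUpTo_mem hτT m, ?_, ?_, fun j hj => Φ.pend_eraseUpTo_of_lt τ m j hj⟩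
          · rw [Φ.pend_eraseUpTo_of_le τ m i₀ (by simp [hi₀])]
            have : i₀ ∈ Φ.chargeLT (m + 1) τ := by rw [hC]; exact hQi
            exact (Φ.mem_chargeLT.1 this).2
          · rw [← Φ.eraseUpTo_succ_of_lt hmn]; exact hE
        have hfib : ∀ τ'' ∈ S'',
            (F.filter fun τ => Φ.eraseUpTo m τ = τ'') =
              T.filter fun τ => Φ.eraseUpTo m τ = τ'' ∧ Φ.chargeLT m τ = Q₀ := by
          intro τ'' hτ''
          rw [hS'', Finset.mem_filter] at hτ''
          obtain ⟨_, hp'', ho'', _⟩ := hτ''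
          ext τ
          simp only [hF, Finset.mem_filter, and_assoc]
          constructor
          · rintro ⟨hτT, _, hC, hE⟩
            refine ⟨hτT, hE, ?_⟩
            rw [hQ₀, ← hC]
            ext j
            simp only [mem_chargeLT, Finset.mem_erase]
            constructor
            · rintro ⟨hj, hpj⟩
              exact ⟨fun h => by rw [h, hi₀] at hj; simp at hj, by omega, hpj⟩
            · rintro ⟨hj, hjm, hpj⟩
              have : (j : ℕ) ≠ m := fun h => hj (Fin.ext (by rw [h]))
              exact ⟨by omega, hpj⟩
          · rintro ⟨hτT, hE, hC⟩
            have hpi₀τ : Φ.pend i₀ τ = true := by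
              rw [← Φ.pend_eraseUpTo_of_le τ m i₀ (by simp [hi₀]), hE]; exact hp''
            refine ⟨hτT, ?_, ?_, hE⟩
            · rw [Φ.eraseUpTo_succ_of_lt hmn, hE]; exact ho''
            · rw [← Finset.insert_erase hQi, ← hQ₀, ← hC]
              ext j
              simp only [mem_chargeLT, Finset.mem_insert]
              constructor
              · rintro ⟨hj, hpj⟩
                by_cases hjm : (j : ℕ) = m
                · exact Or.inl (Fin.ext (by rw [hjm]))
                · exact Or.inr ⟨by omega, hpj⟩
              · rintro (rfl | ⟨hj, hpj⟩)
                · exact ⟨by simp [hi₀], hpi₀τ⟩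
                · exact ⟨by omega, hpj⟩
        have hS''sub : S'' ⊆ T.filter fun τ'' => Φ.pend i₀ τ'' = true ∧ Φ.off i₀ τ'' = τ' := by
          intro τ'' hτ''
          rw [hS'', Finset.mem_filter] at hτ''
          rw [Finset.mem_filter]
          exact ⟨hτ''.1, hτ''.2.1, hτ''.2.2.1⟩
        have hprod0 : 0 ≤ ∏ i ∈ Q₀, x i := Finset.prod_nonneg fun i _ => hx i
        calc ∑ τ ∈ F, A τ
            = ∑ τ'' ∈ S'', ∑ τ ∈ F with Φ.eraseUpTo m τ = τ'', A τ :=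
              (Finset.sum_fiberwise_of_maps_to hmaps A).symm
          _ ≤ ∑ τ'' ∈ S'', A τ'' * ∏ i ∈ Q₀, x i := by
              refine Finset.sum_le_sum fun τ'' hτ'' => ?_
              rw [hfib τ'' hτ'']
              have hm'' := hτ''
              rw [hS'', Finset.mem_filter] at hm''
              exact ih τ'' hm''.1 hm''.2.2.2 Q₀ hQ₀lt
          _ = (∑ τ'' ∈ S'', A τ'') * ∏ i ∈ Q₀, x i := by rw [Finset.sum_mul]
          _ ≤ (∑ τ'' ∈ T with (Φ.pend i₀ τ'' = true ∧ Φ.off i₀ τ'' = τ'), A τ'') * ∏ i ∈ Q₀, x i :=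
              mul_le_mul_of_nonneg_right
                (Finset.sum_le_sum_of_subset_of_nonneg hS''sub fun τ hτ _ => hA τ (Finset.mem_filter.1 hτ).1)
                hprod0
          _ ≤ (x i₀ * A τ') * ∏ i ∈ Q₀, x i := mul_le_mul_of_nonneg_right (h1 i₀ τ' hτ' hpτ'i₀) hprod0
          _ = A τ' * ∏ i ∈ Q, x i := by rw [hQ₀, ← Finset.prod_erase_mul Q x hQi]; ring
      · -- slot `m` is not charged: the fibre is the `m`-fibre
        have hQlt : ∀ i ∈ Q, (i : ℕ) < m := by
          intro i hi
          have h1' := hQ i hi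
          have h2' : (i : ℕ) ≠ m := fun h => hQi (by have : i = i₀ := Fin.ext (by rw [h]); rw [← this]; exact hi)
          omega
        have hset : (T.filter fun τ => Φ.eraseUpTo (m + 1) τ = τ' ∧ Φ.chargeLT (m + 1) τ = Q) =
            T.filter fun τ => Φ.eraseUpTo m τ = τ' ∧ Φ.chargeLT m τ = Q := by
          ext τ
          simp only [Finset.mem_filter]
          constructor
          · rintro ⟨hτT, hE, hC⟩
            have hpi₀τ : Φ.pend i₀ τ = false := by
              by_contra h
              have h' : Φ.pend i₀ τ = true := by simpa using h
              exact hQi (by rw [← hC]; exact Φ.mem_chargeLT.2 ⟨by simp [hi₀], h'⟩)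
            have hE' : Φ.eraseUpTo m τ = τ' := by
              rw [Φ.eraseUpTo_succ_of_lt hmn, Φ.off_of_pend] at hE
              · exact hE
              · rw [Φ.pend_eraseUpTo_of_le τ m i₀ (by simp [hi₀])]; exact hpi₀τ
            refine ⟨hτT, hE', ?_⟩
            rw [← hC]
            ext j
            simp only [mem_chargeLT]
            constructor
            · rintro ⟨hj, hpj⟩; exact ⟨by omega, hpj⟩
            · rintro ⟨hj, hpj⟩
              have : (j : ℕ) ≠ m := by
                intro h
                have : j = i₀ := Fin.ext (by rw [h])
                rw [this] at hpj; rw [hpj] at hpi₀τ; simp at hpi₀τ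
              exact ⟨by omega, hpj⟩
          · rintro ⟨hτT, hE, hC⟩
            have hpi₀τ : Φ.pend i₀ τ = false := by
              rw [← Φ.pend_eraseUpTo_of_le τ m i₀ (by simp [hi₀]), hE]; exact hpτ'i₀
            refine ⟨hτT, ?_, ?_⟩
            · rw [Φ.eraseUpTo_succ_of_lt hmn, hE]; exact Φ.off_of_pend _ _ hpτ'i₀
            · rw [← hC]
              ext j
              simp only [mem_chargeLT]
              constructor
              · rintro ⟨hj, hpj⟩
                have : (j : ℕ) ≠ m := by
                  intro h
                  have : j = i₀ := Fin.ext (by rw [h])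
                  rw [this] at hpj; rw [hpj] at hpi₀τ; simp at hpi₀τ
                exact ⟨by omega, hpj⟩
              · rintro ⟨hj, hpj⟩; exact ⟨by omega, hpj⟩
        rw [hset]
        exact ih τ' hτ' (fun i hi => hpτ' i (by omega)) Q hQlt
    · -- no slot of index `m`: level `m + 1` is level `m`
      have hnm : n ≤ m := not_lt.1 hmn
      have hset : (T.filter fun τ => Φ.eraseUpTo (m + 1) τ = τ' ∧ Φ.chargeLT (m + 1) τ = Q) =
          T.filter fun τ => Φ.eraseUpTo m τ = τ' ∧ Φ.chargeLT m τ = Q := by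
        refine Finset.filter_congr fun τ _ => ?_
        rw [Φ.eraseUpTo_succ_of_le hnm, Φ.chargeLT_of_le hnm, Φ.chargeLT_of_le (by omega)]
      rw [hset]
      exact ih τ' hτ' (fun i hi => hpτ' i (by omega)) Q fun i _ => lt_of_lt_of_le i.isLt hnm

/-- **THE PEELING THEOREM (single-slot conditional ratio bound ⇒ fibre domination).**  If switching ONE slot on in any
frozen context costs at most its activity — `Σ_{τ ∈ T : pend i τ, off i τ = τ″} A τ ≤ x i · A τ″` for every slot `i` and
every `τ″ ∈ T` with `pend i τ″ = false` — and `A ≥ 0` on `T`, `x ≥ 0`, then for every good term `τ′ ∈ T ∖ bad` and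
every slot set `Q` the bad terms erasing to `τ′` with charge `Q` have total weight `≤ A τ′ · ∏_{i ∈ Q} x i`: exactly the
fibre-domination clause of `T4PeierlsDomination.PeierlsDom` / `sum_bad_le_weight_mul_total` for the erasure and charge
of §1. [folklore] -/
theorem fibre_dom (hA : ∀ τ ∈ T, 0 ≤ A τ) (hx : ∀ i, 0 ≤ x i)
    (h1 : ∀ i : Fin n, ∀ τ'' ∈ T, Φ.pend i τ'' = false →
      ∑ τ ∈ T with (Φ.pend i τ = true ∧ Φ.off i τ = τ''), A τ ≤ x i * A τ'') :
    ∀ τ' ∈ T \ Φ.bad, ∀ Q : Finset (Fin n),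
      ∑ τ ∈ Φ.bad with (Φ.erase τ = τ' ∧ Φ.charge τ = Q), A τ ≤ A τ' * ∏ i ∈ Q, x i := by
  intro τ' hτ' Q
  have hτ'T : τ' ∈ T := (Finset.mem_sdiff.1 hτ').1
  have hgood : ∀ i : Fin n, (i : ℕ) < n → Φ.pend i τ' = false := by
    intro i _
    by_contra h
    exact (Finset.mem_sdiff.1 hτ').2 (Φ.mem_bad_of_charge_nonempty hτ'T ⟨i, by simpa using h⟩)
  have hmain := Φ.peel_aux hA hx h1 n τ' hτ'T hgood Q fun i _ => i.isLt
  refine le_trans ?_ hmain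
  refine Finset.sum_le_sum_of_subset_of_nonneg ?_ fun τ hτ _ => hA τ (Finset.mem_filter.1 hτ).1
  intro τ hτ
  rw [Finset.mem_filter] at hτ ⊢
  exact ⟨Φ.bad_subset hτ.1, hτ.2.1, by rw [Φ.chargeLT_n]; exact hτ.2.2⟩

/-- **One run, one cutoff: the relative weight of the bad class** from the single-slot bound and a slot budget:
`Σ_{bad} A ≤ (1 − exp(−Σ_i x i)) · Σ_{T} A` (= `T4PeierlsDomination.sum_bad_le_weight_mul_total` ∘ `fibre_dom`).
[folklore] -/
theorem sum_bad_le (hA : ∀ τ ∈ T, 0 ≤ A τ) (hx : ∀ i, 0 ≤ x i)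
    (h1 : ∀ i : Fin n, ∀ τ'' ∈ T, Φ.pend i τ'' = false →
      ∑ τ ∈ T with (Φ.pend i τ = true ∧ Φ.off i τ = τ''), A τ ≤ x i * A τ'') :
    ∑ τ ∈ Φ.bad, A τ ≤ (1 - Real.exp (-∑ i, x i)) * ∑ τ ∈ T, A τ :=
  sum_bad_le_weight_mul_total (Slots := (Finset.univ : Finset (Fin n))) Φ.erase Φ.charge Φ.bad_subset hA
    (fun i _ => hx i) (fun _ hτ => Φ.erase_mem_sdiff (Φ.bad_subset hτ))
    (fun _ hτ => ⟨Finset.subset_univ _, Φ.charge_nonempty_of_mem_bad hτ⟩)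
    (fun τ' hτ' Q _ => Φ.fibre_dom hA hx h1 τ' hτ' Q)

end Peeling

end SwitchOff

/-! ## §3 The U5 shape `SlotDom` and its liaison to `PeierlsDom` / `RelWeightBound` -/

/-- **R3 IN SINGLE-SLOT FORM (HYPOTHESIS SHAPE; NOT PRINTED, NOT ASSERTED — the cell's NE7b located at its most
primitive clause).**  At each `(K, t)`, `|t| ≤ l₀`: a switch-off structure on the run's term family `T K` whose bad class
IS `Bad K t`, slot activities `x ≥ 0` with `Σ_i x i ≤ S K`, and the SINGLE-SLOT CONDITIONAL RATIO BOUND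
`Σ_{τ ∈ T K : pend i τ, off i τ = τ″} A K t τ ≤ x i · A K t τ″` for every slot `i` and every context `τ″ ∈ T K` with
`pend i τ″ = false`.  DICTIONARY (the cell's reading of [Balaban1989LargeFieldII], NOT a quotation): terms = the
large-field histories `(Z_k, {Y_i})_{k ≤ K}` of the inductive representation (1.104) p. 391 of ONE run after `K` steps,
with their non-negative weights at real `t`; slot `i` = (birth scale `j < j⋆(K)`, anchor cell) ; `pend i τ` = history `τ`
has a component still PENDING (not yet renormalised by ℝ) at step `K` whose first large-field region is anchored at slot
`i`; `off i τ` = the history with that whole component deleted; the fibre of `off i` over a context `τ″` = all ways of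
inserting ONE pending-at-`K` component with first region at slot `i` into the frozen environment `τ″` (all its shapes,
later regions, renewal and merger records); `x i` = the conditional cost of doing so: the banked factors
«exp(−p₀(g_j))» per region creation (p. 383, (1.79)) and per EVENT of the component's pending life (renewal: «K = R_{j+1}»
p. 386; merger surplus p. 386–387, discarded in (1.88)) against the record entropy «exp O(1)(MR_j)^{−d}|Z_j|» and the
couplings «exp O(1)|Z_j ∩ Ω_j|» (p. 383), summed over the records of a component pending for `K − j` steps (§4).  The
UNIFORMITY IN THE CONTEXT `τ″` (other components present; the small-field action, the boundary terms B′^{(k)} of (1.101)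
and the ℝ-operations near the component change when it is deleted) is the unprinted heart of NE7b — failure mode (F1) of
row U5.E-a lives exactly here, as does the Peierls-type insertion estimate itself. [folklore] -/
structure SlotDom {ι : Type*} [DecidableEq ι] (l₀ : ℝ) (T : ℕ → Finset ι) (A : ℕ → ℝ → ι → ℝ)
    (Bad : ℕ → ℝ → Finset ι) (S : ℕ → ℝ) : Prop where
  /-- per `(K, t)`: switch-off structure, activities, budget, bad class, single-slot bound -/
  dom : ∀ K t, |t| ≤ l₀ → ∃ (n : ℕ) (Φ : SwitchOff (T K) n) (x : Fin n → ℝ),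
    (∀ i, 0 ≤ x i) ∧ ∑ i, x i ≤ S K ∧ Bad K t = Φ.bad ∧
    ∀ i : Fin n, ∀ τ'' ∈ T K, Φ.pend i τ'' = false →
      ∑ τ ∈ T K with (Φ.pend i τ = true ∧ Φ.off i τ = τ''), A K t τ ≤ x i * A K t τ''

section Shapes

variable {ι : Type*} [DecidableEq ι] {l₀ : ℝ} {T : ℕ → Finset ι} {A B : ℕ → ℝ → ι → ℝ} {Bad : ℕ → ℝ → Finset ι}
  {S : ℕ → ℝ}

/-- `SlotDom → PeierlsDom` for non-negative weights (the peeling theorem, slot by slot; erasure and charge are those of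
the switch-off structure). [folklore] -/
theorem SlotDom.toPeierlsDom (h : SlotDom l₀ T A Bad S) (hA : ∀ K t, |t| ≤ l₀ → ∀ τ ∈ T K, 0 ≤ A K t τ) :
    PeierlsDom l₀ T A Bad S where
  bad_subset K t ht := by
    obtain ⟨n, Φ, x, _, _, hBad, _⟩ := h.dom K t ht
    rw [hBad]; exact Φ.bad_subset
  dom K t ht := by
    obtain ⟨n, Φ, x, hx, hxS, hBad, h1⟩ := h.dom K t ht
    refine ⟨n, x, Φ.erase, Φ.charge, hx, hxS, ?_, ?_⟩
    · intro τ hτ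
      rw [hBad] at hτ ⊢
      exact ⟨Φ.erase_mem_sdiff (Φ.bad_subset hτ), Φ.charge_nonempty_of_mem_bad hτ⟩
    · intro τ' hτ' Q
      rw [hBad] at hτ' ⊢
      exact Φ.fibre_dom (hA K t ht) hx h1 τ' hτ' Q

/-- One run: `Σ_{Bad} A ≤ (1 − e^{−S K}) · Σ_{T} A` at every `(K, t)`. [folklore] -/
theorem SlotDom.bad_le (h : SlotDom l₀ T A Bad S) (hA : ∀ K t, |t| ≤ l₀ → ∀ τ ∈ T K, 0 ≤ A K t τ) (K : ℕ) (t : ℝ)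
    (ht : |t| ≤ l₀) : ∑ τ ∈ Bad K t, A K t τ ≤ (1 - Real.exp (-S K)) * ∑ τ ∈ T K, A K t τ :=
  (h.toPeierlsDom hA).bad_le hA K t ht

/-- **THE LIAISON (single-slot R3 for both runs ⇒ NE7b's output shape)**: `SlotDom` for run A and run B with a common
slot budget `S ≥ 0`, `Σ_K S K < ∞`, non-negative weights ⇒ `RelWeightBound l₀ T A B Bad (K ↦ 1 − exp(−S K))`.
[folklore] -/
theorem relWeightBound_of_slotDom (hS0 : ∀ K, 0 ≤ S K) (hS : Summable S)
    (hA : ∀ K t, |t| ≤ l₀ → ∀ τ ∈ T K, 0 ≤ A K t τ) (hB : ∀ K t, |t| ≤ l₀ → ∀ τ ∈ T K, 0 ≤ B K t τ)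
    (hDA : SlotDom l₀ T A Bad S) (hDB : SlotDom l₀ T B Bad S) :
    RelWeightBound l₀ T A B Bad (fun K => 1 - Real.exp (-S K)) :=
  relWeightBound_of_peierlsDom hS0 hS hA hB (hDA.toPeierlsDom hA) (hDB.toPeierlsDom hB)

variable {vol : ℝ}

/-- **The analytic end of the uniqueness spine with NE7b discharged down to the SINGLE-SLOT form** — binder-for-binder
`T4PeierlsDomination.cauchySum_of_crossover_peierlsDom` with `SlotDom` in place of `PeierlsDom`.  Every named estimate is
a hypothesis. [folklore] -/
theorem cauchySum_of_crossover_slotDom {E a θ Λ b β' R₁ C : ℝ} {κ₀ : ℕ} {g : ℕ → ℝ} {gs : ℕ → ℕ → ℝ}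
    {Z : ℕ → ℝ → ℝ} (ha0 : 0 < a) (ha1 : a < 1) (hθ : 0 < θ) (hθ1 : θ < 1) (hθΛ : θ ≤ Λ) (hb : 0 < b)
    (h031 : ∀ K, Step.Discrete031 b β' K (g K) (gs K)) (hgs : ∀ K k, k ≤ K → 0 ≤ gs K k) (hR₁ : 0 ≤ R₁)
    (hC : 0 ≤ C) (hκ : 4 < κ₀) (hvol : 0 < vol) (hl₀ : 0 ≤ l₀)
    (hS0 : ∀ K, 0 ≤ S K) (hS : Summable S) (hDA : SlotDom l₀ T A Bad S) (hDB : SlotDom l₀ T B Bad S)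
    (hZA : ∀ K t, |t| ≤ l₀ → Z K t = ∑ τ ∈ T K, A K t τ)
    (hZB : ∀ K t, |t| ≤ l₀ → Z (K + 1) t = ∑ τ ∈ T K, B K t τ)
    (hA : ∀ K t, |t| ≤ l₀ → ∀ τ ∈ T K, 0 ≤ A K t τ) (hB : ∀ K t, |t| ≤ l₀ → ∀ τ ∈ T K, 0 ≤ B K t τ)
    (hpos : ∀ K t, |t| ≤ l₀ → 0 < ∑ τ ∈ T K, A K t τ)
    (hgood : ∀ K : ℕ, ∃ c : ℝ, ∀ t : ℝ, |t| ≤ l₀ → ∀ τ ∈ T K \ Bad K t,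
      Real.exp (c - vol * crossoverDelta E a θ Λ R₁ C κ₀ gs 0 K) * A K t τ ≤ B K t τ ∧
        B K t τ ≤ Real.exp (c + vol * crossoverDelta E a θ Λ R₁ C κ₀ gs 0 K) * A K t τ) :
    MatchingModConstants vol l₀ (crossoverDelta E a θ Λ R₁ C κ₀ gs (fun K => S K / vol)) Z ∧
    Summable (crossoverDelta E a θ Λ R₁ C κ₀ gs (fun K => S K / vol)) ∧
    (∀ t : ℝ, |t| ≤ l₀ → CauchySeq fun K => genFun Z K t) ∧
    TendstoUniformlyOn (fun K t => genFun Z K t) (genFunLim Z) Filter.atTop {t | |t| ≤ l₀} :=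
  cauchySum_of_crossover_peierlsDom (vol := vol) ha0 ha1 hθ hθ1 hθΛ hb h031 hgs hR₁ hC hκ hvol hl₀ hS0 hS
    (hDA.toPeierlsDom hA) (hDB.toPeierlsDom hB) hZA hZB hA hB hpos hgood

end Shapes

/-! ## §4 The slot budget from the typed ingredients R1 / R2 / R4 (counting and geometric sums; nothing of Bałaban's
is asserted — the readings in the docstrings are the cell's) -/

section Budget

/-- **R1 + record entropy + R2 ⇒ ONE SLOT'S ACTIVITY.**  The records `Rec` of a structure (its possible pending lives up
to the cutoff), each with an EVENT count `m r` (renewals and mergers after birth), a cost `0 ≤ c r ≤ ρ^{m r}` (R1: each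
event banks a factor `≤ ρ`, read `ρ = e^{−c_b·p̄₀}`; no sign condition on `c` is needed), at most `Γ^k` records with `k` events (record entropy, read
`Γ = e^{E}` from «exp O(1)(MR_j)^{−d}|Z_j|» p. 383), and every record with at least `m₀` events (R2: pending for
`K − j` steps forces `≥ (K − j + 1)/N − 1` events, `T4WeightBudget.card_Icc_le_of_windows`): the slot activity is
`Σ_r c r ≤ (Γρ)^{m₀}/(1 − Γρ)` as soon as `Γρ < 1`. [folklore] -/
theorem recordSum_le {R : Type*} (Rec : Finset R) (m : R → ℕ) (c : R → ℝ) {ρ Γ : ℝ} (hρ : 0 ≤ ρ) (hΓ : 0 ≤ Γ)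
    (hr : Γ * ρ < 1) {m₀ : ℕ} (hc : ∀ r ∈ Rec, c r ≤ ρ ^ m r)
    (hcount : ∀ k, ((Rec.filter fun r => m r = k).card : ℝ) ≤ Γ ^ k) (hm : ∀ r ∈ Rec, m₀ ≤ m r) :
    ∑ r ∈ Rec, c r ≤ (Γ * ρ) ^ m₀ / (1 - Γ * ρ) := by
  have hmaps : ∀ r ∈ Rec, m r ∈ Rec.image m := fun r hr => Finset.mem_image_of_mem m hr
  calc ∑ r ∈ Rec, c r = ∑ k ∈ Rec.image m, ∑ r ∈ Rec with m r = k, c r :=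
        (Finset.sum_fiberwise_of_maps_to hmaps c).symm
    _ ≤ ∑ k ∈ Rec.image m, ∑ r ∈ Rec with m r = k, ρ ^ k :=
        Finset.sum_le_sum fun k _ => Finset.sum_le_sum fun r hr => by
          have h := Finset.mem_filter.1 hr
          rw [← h.2]; exact hc r h.1
    _ = ∑ k ∈ Rec.image m, ((Rec.filter fun r => m r = k).card : ℝ) * ρ ^ k :=
        Finset.sum_congr rfl fun k _ => by rw [Finset.sum_const, nsmul_eq_mul]
    _ ≤ ∑ k ∈ Rec.image m, Γ ^ k * ρ ^ k :=
        Finset.sum_le_sum fun k _ => mul_le_mul_of_nonneg_right (hcount k) (pow_nonneg hρ k)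
    _ = ∑ k ∈ Rec.image m, (Γ * ρ) ^ k := Finset.sum_congr rfl fun k _ => by rw [mul_pow]
    _ ≤ (Γ * ρ) ^ m₀ / (1 - Γ * ρ) :=
        sum_pow_le_of_le (mul_nonneg hΓ hρ) hr fun k hk => by
          obtain ⟨r, hr', rfl⟩ := Finset.mem_image.1 hk
          exact hm r hr'

/-- **R2's WINDOW COUNT IN RATE FORM.**  With `0 < q ≤ 1` (read `q = Γρ`), a window length `N ≥ 1` and the event count
`a ≤ N·(m₀ + 1)` (`a = K + 1 − j` from `T4WeightBudget.card_Icc_le_of_windows` with `#S = m₀ + 1`, birth included):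
`q^{m₀} ≤ q⁻¹ · (q^{1/N})^{a}` — the per-step survival rate `σ = q^{1/N}` of the two-rate majorant. [folklore] -/
theorem pow_eventCount_le_twoRate {q : ℝ} (hq0 : 0 < q) (hq1 : q ≤ 1) {N : ℕ} (hN : 0 < N) {m₀ a : ℕ}
    (hwin : a ≤ N * (m₀ + 1)) : q ^ m₀ ≤ q⁻¹ * (q ^ ((1 : ℝ) / N)) ^ a := by
  have hNr : (0 : ℝ) < N := by exact_mod_cast hN
  have hexp : (a : ℝ) / N - 1 ≤ m₀ := by
    have h' : (a : ℝ) ≤ N * (m₀ + 1) := by exact_mod_cast hwin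
    rw [sub_le_iff_le_add, div_le_iff₀ hNr]
    linarith [mul_comm (N : ℝ) ((m₀ : ℝ) + 1)]
  have h1 : q ^ m₀ ≤ q ^ ((a : ℝ) / N - 1) := by
    rw [← Real.rpow_natCast q m₀]
    exact Real.rpow_le_rpow_of_exponent_ge hq0 hq1 hexp
  have h2 : q ^ ((a : ℝ) / N - 1) = q⁻¹ * (q ^ ((1 : ℝ) / N)) ^ a := by
    rw [Real.rpow_sub hq0, Real.rpow_one, ← Real.rpow_natCast (q ^ ((1 : ℝ) / N)) a, ← Real.rpow_mul hq0.le,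
      one_div_mul_eq_div, div_eq_mul_inv, mul_comm]
  rw [h2] at h1
  exact h1

/-- **R4 COUNT + SLOT COST ⇒ THE TWO-RATE SLOT BUDGET.**  Slots `Fin n`, each with a birth scale `j i < j⋆ ≤ K` (OLD
slots only); R4: at most `V·Λ^{K − j₀}` slots born at scale `j₀` (read: `vol·L^{4(K−j₀)}` birth positions times the
shape entropy, «exp O(1)(MR_j)^{−d}|Z_j|» p. 383); cost `x i ≤ C·σ^{K − j i}` (from `recordSum_le` and
`pow_eventCount_le_twoRate`).  Then `Σ_i x i ≤ C·V·(Λσ)^{K − j⋆ + 1}/(1 − Λσ)` whenever `Λσ < 1` — i.e. whenever the net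
survival rate of `T4WeightBudget.survivalRate_pos_iff` is positive. [folklore] -/
theorem slotBudget_le {n : ℕ} (x : Fin n → ℝ) (j : Fin n → ℕ) {C V Λ σ : ℝ} (hC : 0 ≤ C) (hV : 0 ≤ V) (hΛ : 0 ≤ Λ)
    (hσ : 0 ≤ σ) (hr : Λ * σ < 1) {jstar K : ℕ} (hj : jstar ≤ K) (hold : ∀ i, j i < jstar)
    (hcount : ∀ j₀ < jstar, (((Finset.univ : Finset (Fin n)).filter fun i => j i = j₀).card : ℝ) ≤ V * Λ ^ (K - j₀))
    (hcost : ∀ i, x i ≤ C * σ ^ (K - j i)) :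
    ∑ i, x i ≤ C * V * ((Λ * σ) ^ (K - jstar + 1) / (1 - Λ * σ)) := by
  have hmaps : ∀ i ∈ (Finset.univ : Finset (Fin n)), j i ∈ Finset.range jstar :=
    fun i _ => Finset.mem_range.2 (hold i)
  have htwo := twoRate_majorant_le (vol := V) hV hΛ hσ hr hj (K := K)
  calc ∑ i, x i = ∑ j₀ ∈ Finset.range jstar, ∑ i ∈ Finset.univ with j i = j₀, x i :=
        (Finset.sum_fiberwise_of_maps_to hmaps x).symm
    _ ≤ ∑ j₀ ∈ Finset.range jstar, ∑ i ∈ Finset.univ with j i = j₀, C * σ ^ (K - j₀) :=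
        Finset.sum_le_sum fun j₀ _ => Finset.sum_le_sum fun i hi => by
          have h := Finset.mem_filter.1 hi
          rw [← h.2]; exact hcost i
    _ = ∑ j₀ ∈ Finset.range jstar, (((Finset.univ : Finset (Fin n)).filter fun i => j i = j₀).card : ℝ) *
          (C * σ ^ (K - j₀)) :=
        Finset.sum_congr rfl fun j₀ _ => by rw [Finset.sum_const, nsmul_eq_mul]
    _ ≤ ∑ j₀ ∈ Finset.range jstar, V * Λ ^ (K - j₀) * (C * σ ^ (K - j₀)) :=
        Finset.sum_le_sum fun j₀ hj₀ => mul_le_mul_of_nonneg_right (hcount j₀ (Finset.mem_range.1 hj₀))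
          (mul_nonneg hC (pow_nonneg hσ _))
    _ = C * (V * ∑ j₀ ∈ Finset.range jstar, Λ ^ (K - j₀) * σ ^ (K - j₀)) := by
        rw [Finset.mul_sum, Finset.mul_sum]
        exact Finset.sum_congr rfl fun j₀ _ => by ring
    _ ≤ C * (V * ((Λ * σ) ^ (K - jstar + 1) / (1 - Λ * σ))) := mul_le_mul_of_nonneg_left htwo hC
    _ = C * V * ((Λ * σ) ^ (K - jstar + 1) / (1 - Λ * σ)) := by ring

/-- The two-rate budget `S K = C·V·r^{K − j⋆(K) + 1}/(1 − r)` is non-negative (`0 ≤ r < 1`, `C, V ≥ 0`). [folklore] -/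
theorem twoRateBudget_nonneg {C V r : ℝ} (hC : 0 ≤ C) (hV : 0 ≤ V) (h0 : 0 ≤ r) (h1 : r < 1) (jstar : ℕ → ℕ)
    (K : ℕ) : 0 ≤ C * V * (r ^ (K - jstar K + 1) / (1 - r)) :=
  mul_nonneg (mul_nonneg hC hV) (div_nonneg (pow_nonneg h0 _) (by linarith))

/-- **SUMMABILITY OF THE TWO-RATE BUDGET OVER THE NUMBER OF STEPS** when the crossover scale leaves a positive fraction
of the steps old: `c·K ≤ K − j⋆(K)` (`T4WeightBudget.summable_weightMajorant`). [folklore] -/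
theorem summable_twoRateBudget {C V r c : ℝ} (hC : 0 ≤ C) (hV : 0 ≤ V) (h0 : 0 < r) (h1 : r < 1) (hc : 0 < c)
    {jstar : ℕ → ℕ} (hfrac : ∀ K : ℕ, c * K ≤ ((K - jstar K : ℕ) : ℝ)) :
    Summable fun K => C * V * (r ^ (K - jstar K + 1) / (1 - r)) := by
  have h := summable_weightMajorant (V := C * V * r / (1 - r)) h0 h1
    (div_nonneg (mul_nonneg (mul_nonneg hC hV) h0.le) (by linarith)) hc hfrac
  refine h.congr fun K => ?_
  rw [pow_succ]
  ring

/-- **THE BUDGET END OF THE ROW ASSEMBLED**: single-slot dominations of both runs with the two-rate budget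
`S K = C·V·r^{K − j⋆(K) + 1}/(1 − r)`, `0 < r < 1`, `c·K ≤ K − j⋆(K)`, and non-negative weights ⇒ `RelWeightBound` with
weights `1 − exp(−S K)`. [folklore] -/
theorem relWeightBound_of_slotDom_twoRate {ι : Type*} [DecidableEq ι] {l₀ : ℝ} {T : ℕ → Finset ι}
    {A B : ℕ → ℝ → ι → ℝ} {Bad : ℕ → ℝ → Finset ι} {C V r c : ℝ} (hC : 0 ≤ C) (hV : 0 ≤ V) (h0 : 0 < r)
    (h1 : r < 1) (hc : 0 < c) {jstar : ℕ → ℕ} (hfrac : ∀ K : ℕ, c * K ≤ ((K - jstar K : ℕ) : ℝ))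
    (hA : ∀ K t, |t| ≤ l₀ → ∀ τ ∈ T K, 0 ≤ A K t τ) (hB : ∀ K t, |t| ≤ l₀ → ∀ τ ∈ T K, 0 ≤ B K t τ)
    (hDA : SlotDom l₀ T A Bad fun K => C * V * (r ^ (K - jstar K + 1) / (1 - r)))
    (hDB : SlotDom l₀ T B Bad fun K => C * V * (r ^ (K - jstar K + 1) / (1 - r))) :
    RelWeightBound l₀ T A B Bad fun K => 1 - Real.exp (-(C * V * (r ^ (K - jstar K + 1) / (1 - r)))) :=
  relWeightBound_of_slotDom (twoRateBudget_nonneg hC hV h0.le h1 jstar) (summable_twoRateBudget hC hV h0 h1 hc hfrac)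
    hA hB hDA hDB

end Budget

/-! ## §5 Sanity: the independent-structure model inhabits `SlotDom` with equality in each fibre -/

section Product

variable {n : ℕ}

/-- The INDEPENDENT-STRUCTURE MODEL: terms are the on/off patterns `Fin n → Bool` of `n` slots, `pend i τ = τ i`,
`off i τ = update τ i false`. [folklore] -/
def productSwitchOff (n : ℕ) : SwitchOff (Finset.univ : Finset (Fin n → Bool)) n where
  pend i τ := τ i
  off i τ := Function.update τ i false
  off_mem _ _ _ := Finset.mem_univ _
  pend_off_self i τ := by simp
  pend_off_ne i i' τ h := by simp [Function.update_of_ne h]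
  off_of_pend i τ h := by
    have h' : τ i = false := h
    rw [← h']
    exact Function.update_eq_self i τ

/-- Product weights: `a₀ · ∏_{i on} u i`. [folklore] -/
def productWeight (a₀ : ℝ) (u : Fin n → ℝ) (τ : Fin n → Bool) : ℝ := a₀ * ∏ i, (if τ i then u i else 1)

/-- Product weights are non-negative for `a₀, u ≥ 0`. [folklore] -/
theorem productWeight_nonneg {a₀ : ℝ} {u : Fin n → ℝ} (ha : 0 ≤ a₀) (hu : ∀ i, 0 ≤ u i) (τ : Fin n → Bool) :
    0 ≤ productWeight a₀ u τ :=
  mul_nonneg ha (Finset.prod_nonneg fun i _ => by split_ifs; exacts [hu i, zero_le_one])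

/-- Switching slot `i` on multiplies a product weight by `u i`. [folklore] -/
theorem productWeight_update_true {a₀ : ℝ} {u : Fin n → ℝ} {τ : Fin n → Bool} {i : Fin n} (hi : τ i = false) :
    productWeight a₀ u (Function.update τ i true) = u i * productWeight a₀ u τ := by
  unfold productWeight
  rw [← Finset.mul_prod_erase Finset.univ _ (Finset.mem_univ i),
    ← Finset.mul_prod_erase Finset.univ (fun j => if τ j then u j else 1) (Finset.mem_univ i)]
  simp only [Function.update_self, if_true, hi]
  have : ∏ j ∈ Finset.univ.erase i, (if Function.update τ i true j then u j else 1) =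
      ∏ j ∈ Finset.univ.erase i, (if τ j then u j else 1) :=
    Finset.prod_congr rfl fun j hj => by rw [Function.update_of_ne (Finset.ne_of_mem_erase hj)]
  rw [this]
  simp
  ring

/-- **In the independent model the single-slot bound holds with `x = u` and EQUALITY**: the fibre of `off i` over a
context `τ″` with `τ″ i = false` is the single pattern `update τ″ i true`. [folklore] -/
theorem productSwitchOff_single_slot (a₀ : ℝ) (u : Fin n → ℝ) (i : Fin n) (τ'' : Fin n → Bool) (hτ'' : τ'' i = false) :
    ∑ τ ∈ (Finset.univ : Finset (Fin n → Bool)) with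
        ((productSwitchOff n).pend i τ = true ∧ (productSwitchOff n).off i τ = τ''), productWeight a₀ u τ =
      u i * productWeight a₀ u τ'' := by
  have hset : ((Finset.univ : Finset (Fin n → Bool)).filter fun τ =>
      (productSwitchOff n).pend i τ = true ∧ (productSwitchOff n).off i τ = τ'') = {Function.update τ'' i true} := by
    ext τ
    simp only [productSwitchOff, Finset.mem_filter, Finset.mem_univ, true_and, Finset.mem_singleton]
    constructor
    · rintro ⟨hτi, hoff⟩
      rw [← hoff, Function.update_idem, ← hτi, Function.update_eq_self]
    · rintro rfl
      refine ⟨by simp, ?_⟩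
      rw [Function.update_idem, ← hτ'', Function.update_eq_self]
  rw [hset, Finset.sum_singleton, productWeight_update_true hτ'']

/-- **`SlotDom` IS INHABITED NON-TRIVIALLY**: the independent model with `n` slots of activities `u K ≥ 0` at cutoff
`K`, weights `a₀ · ∏_{i on} u K i` (the same at every `t`), bad class = the patterns with a slot on, budget
`S K = Σ_i u K i`. [folklore] -/
theorem slotDom_product (l₀ a₀ : ℝ) (u : ℕ → Fin n → ℝ) (hu : ∀ K i, 0 ≤ u K i) :
    SlotDom l₀ (fun _ => (Finset.univ : Finset (Fin n → Bool))) (fun K _ τ => productWeight a₀ (u K) τ)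
      (fun _ _ => (productSwitchOff n).bad) fun K => ∑ i, u K i where
  dom K _ _ := ⟨n, productSwitchOff n, u K, hu K, le_rfl, rfl,
    fun i τ'' _ hτ'' => (productSwitchOff_single_slot a₀ (u K) i τ'' hτ'').le⟩

end Product

end Literature.MathematicalPhysics.QuantumFieldTheory.Balaban1983to89.T4HistoryPeeling
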